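import Literature.IUT.HodgeArakelov.CohomologyLimitKummerMLF
import Literature.IUT.HodgeArakelov.TemperedThetaMonoidsProofs3

/-!
# [IUTchII] §3, Prop 3.1 (ii) — both printed clauses of "the constant monoid `Ψ_cns(M^Θ_*)`" for every
# `ThetaEnvData` whose ambient module IS the GENUINE continuous cohomology limit `lim_K H¹(Π_Ÿ ⊓ K, Π_μ)` and
# whose constants are the Kummer image of `𝒪_k̄^▷` (proof-only; abc-iut cell, layer L6; GAP-LEDGER G-w4d019-1)

S. Mochizuki, *Inter-universal Teichmüller theory II*, §3, Proposition 3.1 (ii) p. 88 [cite: Mochizuki2012,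
Prop 3.1 (ii) p.88]: "By applying the cyclotomic rigidity isomorphisms of Corollaries 2.8, (i); 2.9 to the
inverse of the Kummer isomorphism `M^Θ_* ↦ {O^×·∞θ^ι_env(M^Θ_*) ⥲ O^×·∞θ^ι(M^Θ_*)}_ι` … one obtains a functorial
algorithm `M^Θ_* ↦ Ψ_cns(M^Θ_*) := M_TM(M^Θ_*) ⊆ lim_J H¹(Π_Ÿ(M^Θ_*)|_J, Π_μ(M^Θ_*))` for constructing a 'monoid
of constants' — i.e., which is naturally isomorphic to `O^▷_{F̄_v}` [cf. Example 1.8, (ii)] — equipped with a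
natural conjugation action by `Π_X(M^Θ_*)`."  Claim key DISPUTED (D-0012); PROOF-ONLY (no definitions); node
**IUTchII:Prop3.1(ii)**; nothing here takes a side on [IUTchIII] Cor 3.12.

THIS FILE supersedes the hypothesis shape of `TemperedThetaMonoidsModelProofs.lean` (abc-iut-w4-d007 gen 0,
p413806), where the ambient module was the DISCRETE model colimit and "the cyclotomic-rigidity change of
coefficients `φ : cohLim ≃* E.H`" stayed an equivariant-isomorphism HYPOTHESIS.  Now (`CohomologyLimitKummer.lean`
+ `CohomologyLimitKummerMLF.lean`) the Kummer map lands in abc-iut-L6-t1's GENUINE limit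
`Multiplicative (h1Lim φ A' Π_Ÿ ⊥) = lim_K H¹(Π_Ÿ ⊓ K, A')` of L2's continuous `H¹` (`CohomologySystemOfContH1`,
p411226 — the very object the `θ`-side files `EtaleThetaDataOfSetting` / `CohomologyLimitConj` use), with
conjugation action `h1LimConjMulAut` (abc-iut-w4-d043's `h1LimConj`) and Kummer map `h1LimKummerConstants`
(INJECTIVE and `Π_k`-EQUIVARIANT as THEOREMS), the change of coefficient cyclotome being the printed DATUM
`c : CyclotomeCoefficients φ A' k̄ˣ` with `c.hom : Λ(k̄ˣ) = μ_Ẑ ⥲ A'` bijective ([IUTchII] Cor. 1.11 (a),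
Cors. 2.8 (i), 2.9).  The only identification left is the BOOKKEEPING one between abc-iut-L6-t2's bundled field
`E.H : CommGrpCat` and this limit: a `Π_k`-equivariant `ψ : Multiplicative (h1Lim φ A' Π_Ÿ ⊥) ≃* E.H` — for an `E`
packaged with `H := ⟨lim⟩`, `conj := h1LimConjMulAut` it is `MulEquiv.refl` with `hψ` by `rfl`.
CONCLUSIONS for every such `E` over `Π_k` (MLF model `C`, `D` of abc-iut-L4; `Π_Ÿ := HH ⊴ Π_k` any normal subgroup
with finite-index image in `G_k`): `constants_stable` HOLDS (`constants_stable_ofLimit`); "naturally isomorphic to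
`O^▷_{F̄_v}`": `𝒪_k̄^▷ ≃* Ψ_cns`, equal to `ψ ∘ κ` on elements, INTERTWINING the `Π_k`-actions, UNIQUE
(`exists_constantMonoid_mulEquiv_ofLimit`, `constantMonoid_mulEquiv_ofLimit_unique`); `M^×_TM` = the Kummer image
of `𝒪_k̄^×` (`kummer_mem_units_iff_ofLimit`, `units_coe_eq_image_ofLimit`).
-/

namespace Literature.IUT.HodgeArakelov

namespace TemperedThetaMonoids

open Literature.AnabelianGeometry.AbsoluteAnabelian Literature.AnabelianGeometry.EtaleTheta
open CohomologySystemOfContH1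

universe v

section Limit

variable (C : MLFClosure.{0}) (D : ModelMLFGaloisData C.k C.K)
  {G' : Type} [Group G'] [TopologicalSpace G'] [IsTopologicalGroup G']
  (φ : (TopGroup.of D.Pi) →* G') (A' : Subgroup G') [A'.Normal] [IsMulCommutative A']
  (HH : Subgroup (TopGroup.of D.Pi)) [HH.Normal] [TopologicalSpace (C.K)ˣ]
  (c : CyclotomeCoefficients φ A' (C.K)ˣ) (E : ThetaEnvData.{0, v} D.Pi)
  (ψ : Multiplicative (h1Lim φ A' HH ⊥) ≃* E.H)

/-- The `Π_k`-action on `𝒪_k̄^▷` and the Kummer map into the limit are compatible in the shape `hequiv₀` of the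
transport theorems (`h1LimKummerConstants_smul`). [cite: Mochizuki2012, Prop 3.1 (ii) p.88] -/
theorem h1LimKummerConstants_toMulAut (g : D.Pi) (m : nonzeroIntegers C.k C.K) :
    h1LimKummerConstants C D φ A' HH c (MulDistribMulAction.toMulAut D.Pi (nonzeroIntegers C.k C.K) g m) =
      h1LimConjMulAut φ A' HH g (h1LimKummerConstants C D φ A' HH c m) :=
  h1LimKummerConstants_smul C D φ A' HH c g m

/-- **[IUTchII] Prop 3.1 (ii), "equipped with a natural conjugation action by `Π_X(M^Θ_*)`", for the GENUINE
ambient module**: if `E.H` is (`ψ`, `Π_k`-equivariantly) the continuous cohomology limit `lim_K H¹(Π_Ÿ ⊓ K, A')`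
and the constants are the Kummer image of `𝒪_k̄^▷`, the typed clause `Prop31Statements.constants_stable` HOLDS.
[cite: Mochizuki2012, Prop 3.1 (ii) p.88] -/
theorem constants_stable_ofLimit
    (hψ : ∀ (g : D.Pi) (y : Multiplicative (h1Lim φ A' HH ⊥)), ψ (h1LimConjMulAut φ A' HH g y) = E.conj g (ψ y))
    (hrange : MonoidHom.mrange (ψ.toMonoidHom.comp (h1LimKummerConstants C D φ A' HH c)) = E.constants) :
    E.IsConjStable E.constantMonoid :=
  constants_stable_transport E (MulDistribMulAction.toMulAut D.Pi (nonzeroIntegers C.k C.K))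
    (h1LimConjMulAut φ A' HH) (h1LimKummerConstants C D φ A' HH c) ψ hrange
    (fun g m => h1LimKummerConstants_toMulAut C D φ A' HH c g m) hψ

variable [(Subgroup.map D.aug HH).FiniteIndex]

/-- **[IUTchII] Prop 3.1 (ii), "a 'monoid of constants' … naturally isomorphic to `O^▷_{F̄_v}` … equipped with a
natural conjugation action", for the GENUINE ambient module**: with `c.hom : Λ(k̄ˣ) ⥲ A'` bijective (the
cyclotomic-rigidity datum) there is an isomorphism `𝒪_k̄^▷ ⥲ Ψ_cns(M^Θ_*)` which is the Kummer map on elements and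
intertwines the `Π_k`-action on `𝒪_k̄^▷` with the conjugation action on `Ψ_cns`. [cite: Mochizuki2012, Prop 3.1 (ii) p.88] -/
theorem exists_constantMonoid_mulEquiv_ofLimit (hc : Function.Bijective c.hom)
    (hψ : ∀ (g : D.Pi) (y : Multiplicative (h1Lim φ A' HH ⊥)), ψ (h1LimConjMulAut φ A' HH g y) = E.conj g (ψ y))
    (hrange : MonoidHom.mrange (ψ.toMonoidHom.comp (h1LimKummerConstants C D φ A' HH c)) = E.constants) :
    ∃ e : nonzeroIntegers C.k C.K ≃* E.constantMonoid,
      (∀ m, ((e m : E.constantMonoid) : E.H) = ψ (h1LimKummerConstants C D φ A' HH c m)) ∧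
        ∀ (g : D.Pi) (m : nonzeroIntegers C.k C.K),
          ((e (g • m) : E.constantMonoid) : E.H) = E.conj g ((e m : E.constantMonoid) : E.H) :=
  exists_constantMonoid_mulEquiv_transport E (MulDistribMulAction.toMulAut D.Pi (nonzeroIntegers C.k C.K))
    (h1LimConjMulAut φ A' HH) (h1LimKummerConstants C D φ A' HH c) ψ
    (h1LimKummerConstants_injective C D φ A' HH c hc) hrange
    (fun g m => h1LimKummerConstants_toMulAut C D φ A' HH c g m) hψ

omit [HH.Normal] [(Subgroup.map D.aug HH).FiniteIndex] in
/-- **"naturally"**: the isomorphism `𝒪_k̄^▷ ⥲ Ψ_cns` commuting with the Kummer map into the limit is UNIQUE.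
[cite: Mochizuki2012, Prop 3.1 (ii) p.88] -/
theorem constantMonoid_mulEquiv_ofLimit_unique (e e' : nonzeroIntegers C.k C.K ≃* E.constantMonoid)
    (he : ∀ m, ((e m : E.constantMonoid) : E.H) = ψ (h1LimKummerConstants C D φ A' HH c m))
    (he' : ∀ m, ((e' m : E.constantMonoid) : E.H) = ψ (h1LimKummerConstants C D φ A' HH c m)) : e = e' :=
  constantMonoid_mulEquiv_unique E (ψ.toMonoidHom.comp (h1LimKummerConstants C D φ A' HH c)) e e' he he'

omit [HH.Normal] in
/-- The unit group `M^×_TM ⊆ Ψ_cns` of the statement file corresponds to the units of `𝒪_k̄^▷` (`O^×_{F̄_v}`):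
`ψ(κ m) ∈ M^×_TM ↔ IsUnit m`. [cite: Mochizuki2012, Prop 3.1 (ii) p.88] -/
theorem kummer_mem_units_iff_ofLimit (hc : Function.Bijective c.hom)
    (hrange : MonoidHom.mrange (ψ.toMonoidHom.comp (h1LimKummerConstants C D φ A' HH c)) = E.constants)
    (m : nonzeroIntegers C.k C.K) : ψ (h1LimKummerConstants C D φ A' HH c m) ∈ E.units ↔ IsUnit m :=
  kummer_mem_units_iff E (ψ.toMonoidHom.comp (h1LimKummerConstants C D φ A' HH c))
    (ψ.injective.comp (h1LimKummerConstants_injective C D φ A' HH c hc)) hrange m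

omit [HH.Normal] in
/-- … so that `M^×_TM` IS the Kummer image (in the genuine limit) of the unit group `𝒪_k̄^× ⊆ 𝒪_k̄^▷`.
[cite: Mochizuki2012, Prop 3.1 (ii) p.88] -/
theorem units_coe_eq_image_ofLimit (hc : Function.Bijective c.hom)
    (hrange : MonoidHom.mrange (ψ.toMonoidHom.comp (h1LimKummerConstants C D φ A' HH c)) = E.constants) :
    (E.units : Set E.H) =
      (fun m => ψ (h1LimKummerConstants C D φ A' HH c m)) '' {m : nonzeroIntegers C.k C.K | IsUnit m} :=
  units_coe_eq_image_isUnit E (ψ.toMonoidHom.comp (h1LimKummerConstants C D φ A' HH c))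
    (ψ.injective.comp (h1LimKummerConstants_injective C D φ A' HH c hc)) hrange

end Limit

end TemperedThetaMonoids

end Literature.IUT.HodgeArakelov
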